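import Summits.ResolutionOfSingularities.ResolutionOfSingularities.Theorems.PurelyInseparableDim4ResConeMidTameSlices
import Summits.ResolutionOfSingularities.ResolutionOfSingularities.Theorems.PurelyInseparableDim4ResConeSatChain
import Summits.ResolutionOfSingularities.ResolutionOfSingularities.Theorems.PurelyInseparableDim4FreeTail
import Summits.ResolutionOfSingularities.ResolutionOfSingularities.Theorems.PurelyInseparableDim4ResConeSatelliteResidual
import HarnessLib
import HarnessLib.Audit.Tags

/-!
# Purely inseparable four-folds — K2(p) AS «NO LIGHT POWER-CONE TRAP ∧ NO BINARY-CONE TRAP» (slice B (K14), the BOARD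
# PACKAGING of the (DL) kernel), stated MODULO the light-satellite recurrence K12c (taken as a hypothesis `hK12c`)

[OURS · counted 0 · cell `res-dim4-pi` · K2(p) lane, SLICE-B architecture of record (holder res-dim4-p-12 g3, brick (K14)
«the board packaging» named for res-dim4-p-2 g3 on the bus 2026-08-29T00:02:49Z) · K lane crit-4 g2.]  Nothing here
proves K2(p) = `RidgeBudget.NoAboveFloorTrap p p`, K2(5), `NoIsolatedTrap p p` or resolution of singularities in
dimension ≥ 4 / characteristic `p`.  AI kernel work, weaker than expert review.

DRAFT-OF-RECORD SHAPE (HOME-first; files when res-dim4-p-1 g3's K12c lands): the light-satellite recurrence K12c —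
«on a slice-B chain with witnesses, for every `N` some satellite step `k ≥ N` has `o_k + o_{k+1} + 3 ≤ 3p`» — enters as
the HYPOTHESIS `hK12c` (its announced shape, by value; no `def`); the successor replaces `hK12c` by p-1's theorem.

* `lightSlices_of_noAboveFloorTrap` (→, unconditional): K2(p) ⇒ no LIGHT slice-B trap and no slice-C trap
  (`K2BaseChange.noAboveFloorTrap_iff_midTameSlices`, p675531);
* `noAboveFloorTrap_of_lightSlices_of` (←, modulo `hK12c`): a slice-B chain has witnesses (`FreeTail.exists_witnesses`)
  and is light infinitely often by `hK12c` — excluded; slice C excluded by hypothesis; hence K2(p) by p675531;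
* **`noAboveFloorTrap_iff_lightSlices_of (hK12c)`** — the located residue of record after K11–K13:
  «K2(p) ⟺ no LIGHT power-cone trap ∧ no binary-cone trap»;
* p = 5: `light_iff_six_six` (on an isolated above-floor `Step0 5` chain, `o_k + o_{k+1} + 3 ≤ 15 ⟺ (o_k, o_{k+1}) =
  (6, 6)`, from `ResCone.chain_band`: `5 < o < 10`) and **`noAboveFloorTrap_five_iff_lightSlices_of (hK12c)`** —
  «K2(5) ⟺ no power-cone trap returning infinitely often to a satellite step at orders (6, 6) ∧ no binary-cone trap»
  (idea-4's A∞/C∞ regime).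

[cite: CossartJannsenSaito2020, Thm. 3.14]
bears_on: LADDER-RESOLUTION:D157-DOOR2 (res-dim4-pi · K2(p) slice B · (K14) board packaging, modulo K12c).
Supports stmt-ResolutionOfSingularities-16155 (helper).
-/

set_option linter.dupNamespace false -- mandated namespace of this single-conjunct summit

noncomputable section

namespace Summit.ResolutionOfSingularities.ResolutionOfSingularities.Theorems.PIDim4

namespace ResCone

open MvPolynomial
open Literature.AlgebraicGeometry.Resolution
open Literature.AlgebraicGeometry.Resolution.CentreBlowup
open Literature.AlgebraicGeometry.Resolution.Hauser2010
open Literature.AlgebraicGeometry.Resolution.HauserPerlega2019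
open RidgeBudget (NoAboveFloorTrap)

/-- **K2(p) ⇒ no LIGHT power-cone trap and no binary-cone trap** (the easy direction, unconditional): a light slice-B
chain is in particular a slice-B chain. [OURS · bookkeeping] [cite: CossartJannsenSaito2020, Thm. 3.14] -/
theorem lightSlices_of_noAboveFloorTrap (p : ℕ) [Fact p.Prime] (h : NoAboveFloorTrap p p) (K : Type) [Field K]
    [CharP K p] [DecidableEq K] :
    (¬ ∃ (c : ℕ → State K) (d : ℕ) (j : ℕ → Fin 4) (b : ℕ → Fin 4 → K), 2 ≤ d ∧ d < p ∧
        (∀ e' ∈ (c 0).F.support, (c 0).r ≤ e') ∧ FreeTail.IsWitnessedChain p c j b ∧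
        (∀ k, IsIsolated p (c k).F ∧ Step0 p (c k) (c (k + 1)) ∧ ordZero (c k).F ≠ p ∧
          (c k).shade = (d : ℕ∞) ∧ Module.finrank K (resVertex (c k)) = 3) ∧
        ∀ N, ∃ k, N ≤ k ∧ FreeTail.IsSatellite j b k ∧
          (ordZero (c k).F).toNat + (ordZero (c (k + 1)).F).toNat + 3 ≤ 3 * p) ∧
    (¬ ∃ (c : ℕ → State K) (d : ℕ), 2 ≤ d ∧ d < p ∧
        (∀ e' ∈ (c 0).F.support, (c 0).r ≤ e') ∧
        ∀ k, IsIsolated p (c k).F ∧ Step0 p (c k) (c (k + 1)) ∧ ordZero (c k).F ≠ p ∧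
          (c k).shade = (d : ℕ∞) ∧ Module.finrank K (resVertex (c k)) = 2) := by
  obtain ⟨hB, hC⟩ := (K2BaseChange.noAboveFloorTrap_iff_midTameSlices p).mp h K
  exact ⟨fun ⟨c, d, _, _, hd2, hdp, hr0, _, hc, _⟩ => hB ⟨c, d, hd2, hdp, hr0, hc⟩, hC⟩

/-- **No LIGHT power-cone trap ∧ no binary-cone trap ⇒ K2(p), MODULO the light-satellite recurrence K12c** (taken as
the hypothesis `hK12c`, res-dim4-p-1 g3's announced shape): a slice-B chain has witnesses (`FreeTail.exists_witnesses`)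
and is then light infinitely often by `hK12c`, which the first hypothesis excludes; slice C is the second hypothesis;
`K2BaseChange.noAboveFloorTrap_iff_midTameSlices` concludes. [OURS · conditional on K12c]
[cite: CossartJannsenSaito2020, Thm. 3.14] -/
theorem noAboveFloorTrap_of_lightSlices_of (p : ℕ) [Fact p.Prime]
    (hK12c : ∀ (K : Type) [Field K] [CharP K p] [DecidableEq K] (c : ℕ → State K) (d : ℕ) (j : ℕ → Fin 4)
      (b : ℕ → Fin 4 → K), 2 ≤ d → d < p → (∀ e' ∈ (c 0).F.support, (c 0).r ≤ e') →
      FreeTail.IsWitnessedChain p c j b →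
      (∀ k, IsIsolated p (c k).F ∧ Step0 p (c k) (c (k + 1)) ∧ ordZero (c k).F ≠ p ∧
        (c k).shade = (d : ℕ∞) ∧ Module.finrank K (resVertex (c k)) = 3) →
      ∀ N, ∃ k, N ≤ k ∧ FreeTail.IsSatellite j b k ∧
        (ordZero (c k).F).toNat + (ordZero (c (k + 1)).F).toNat + 3 ≤ 3 * p)
    (h : ∀ (K : Type) [Field K] [CharP K p] [DecidableEq K],
      (¬ ∃ (c : ℕ → State K) (d : ℕ) (j : ℕ → Fin 4) (b : ℕ → Fin 4 → K), 2 ≤ d ∧ d < p ∧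
          (∀ e' ∈ (c 0).F.support, (c 0).r ≤ e') ∧ FreeTail.IsWitnessedChain p c j b ∧
          (∀ k, IsIsolated p (c k).F ∧ Step0 p (c k) (c (k + 1)) ∧ ordZero (c k).F ≠ p ∧
            (c k).shade = (d : ℕ∞) ∧ Module.finrank K (resVertex (c k)) = 3) ∧
          ∀ N, ∃ k, N ≤ k ∧ FreeTail.IsSatellite j b k ∧
            (ordZero (c k).F).toNat + (ordZero (c (k + 1)).F).toNat + 3 ≤ 3 * p) ∧
      (¬ ∃ (c : ℕ → State K) (d : ℕ), 2 ≤ d ∧ d < p ∧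
          (∀ e' ∈ (c 0).F.support, (c 0).r ≤ e') ∧
          ∀ k, IsIsolated p (c k).F ∧ Step0 p (c k) (c (k + 1)) ∧ ordZero (c k).F ≠ p ∧
            (c k).shade = (d : ℕ∞) ∧ Module.finrank K (resVertex (c k)) = 2)) :
    NoAboveFloorTrap p p := by
  refine (K2BaseChange.noAboveFloorTrap_iff_midTameSlices p).mpr fun K _ _ _ => ?_
  obtain ⟨hB, hC⟩ := h K
  refine ⟨fun ⟨c, d, hd2, hdp, hr0, hc⟩ => ?_, hC⟩
  obtain ⟨j, b, hw⟩ := FreeTail.exists_witnesses (fun k => (hc k).2.1)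
  exact hB ⟨c, d, j, b, hd2, hdp, hr0, hw, hc, hK12c K c d j b hd2 hdp hr0 hw hc⟩

/-- **THE LOCATED RESIDUE after the (DL) kernel, modulo K12c: K2(p) ⟺ no LIGHT power-cone trap ∧ no binary-cone trap.**
For every prime `p`: `RidgeBudget.NoAboveFloorTrap p p` holds iff over every field of characteristic `p` there is
(B-light) no isolated above-floor `Step0 p` chain with `x^{r₀} ∣ F₀`, witnesses `(j, b)`, constant shade `2 ≤ d < p` and
`e_G ≡ 3`, returning beyond every index to a SATELLITE step with `o_k + o_{k+1} + 3 ≤ 3p`, and (C) no such chain with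
`e_G ≡ 2` — GIVEN the light-satellite recurrence K12c as the hypothesis `hK12c`. [OURS · conditional on K12c]
[cite: CossartJannsenSaito2020, Thm. 3.14] -/
theorem noAboveFloorTrap_iff_lightSlices_of (p : ℕ) [Fact p.Prime]
    (hK12c : ∀ (K : Type) [Field K] [CharP K p] [DecidableEq K] (c : ℕ → State K) (d : ℕ) (j : ℕ → Fin 4)
      (b : ℕ → Fin 4 → K), 2 ≤ d → d < p → (∀ e' ∈ (c 0).F.support, (c 0).r ≤ e') →
      FreeTail.IsWitnessedChain p c j b →
      (∀ k, IsIsolated p (c k).F ∧ Step0 p (c k) (c (k + 1)) ∧ ordZero (c k).F ≠ p ∧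
        (c k).shade = (d : ℕ∞) ∧ Module.finrank K (resVertex (c k)) = 3) →
      ∀ N, ∃ k, N ≤ k ∧ FreeTail.IsSatellite j b k ∧
        (ordZero (c k).F).toNat + (ordZero (c (k + 1)).F).toNat + 3 ≤ 3 * p) :
    NoAboveFloorTrap p p ↔ ∀ (K : Type) [Field K] [CharP K p] [DecidableEq K],
      (¬ ∃ (c : ℕ → State K) (d : ℕ) (j : ℕ → Fin 4) (b : ℕ → Fin 4 → K), 2 ≤ d ∧ d < p ∧
          (∀ e' ∈ (c 0).F.support, (c 0).r ≤ e') ∧ FreeTail.IsWitnessedChain p c j b ∧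
          (∀ k, IsIsolated p (c k).F ∧ Step0 p (c k) (c (k + 1)) ∧ ordZero (c k).F ≠ p ∧
            (c k).shade = (d : ℕ∞) ∧ Module.finrank K (resVertex (c k)) = 3) ∧
          ∀ N, ∃ k, N ≤ k ∧ FreeTail.IsSatellite j b k ∧
            (ordZero (c k).F).toNat + (ordZero (c (k + 1)).F).toNat + 3 ≤ 3 * p) ∧
      (¬ ∃ (c : ℕ → State K) (d : ℕ), 2 ≤ d ∧ d < p ∧
          (∀ e' ∈ (c 0).F.support, (c 0).r ≤ e') ∧
          ∀ k, IsIsolated p (c k).F ∧ Step0 p (c k) (c (k + 1)) ∧ ordZero (c k).F ≠ p ∧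
            (c k).shade = (d : ℕ∞) ∧ Module.finrank K (resVertex (c k)) = 2) :=
  ⟨fun h K _ _ _ => lightSlices_of_noAboveFloorTrap p h K, noAboveFloorTrap_of_lightSlices_of p hK12c⟩

/-! ## p = 5: the light satellite steps are exactly the `(6, 6)` steps -/

/-- **At `p = 5`, «light» means orders `(6, 6)`**: on an isolated above-floor `Step0 5` chain every order lies in
`{6, …, 9}` (`ResCone.chain_band`), so `o_k + o_{k+1} + 3 ≤ 15 ⟺ o_k = o_{k+1} = 6`. [OURS · arithmetic]
[cite: CossartJannsenSaito2020, Thm. 3.14] -/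
theorem light_iff_six_six {K : Type} [Field K] [CharP K 5] [DecidableEq K] {c : ℕ → State K}
    (hc : ∀ k, IsIsolated 5 (c k).F ∧ Step0 5 (c k) (c (k + 1))) (hfloor : ∀ k, ordZero (c k).F ≠ (5 : ℕ)) (k : ℕ) :
    (ordZero (c k).F).toNat + (ordZero (c (k + 1)).F).toNat + 3 ≤ 3 * 5 ↔
      ordZero (c k).F = (6 : ℕ) ∧ ordZero (c (k + 1)).F = (6 : ℕ) := by
  haveI : Fact (Nat.Prime 5) := ⟨by norm_num⟩
  obtain ⟨o, ho, h5o, ho10⟩ := chain_band 5 hc hfloor k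
  obtain ⟨o', ho', h5o', ho10'⟩ := chain_band 5 hc hfloor (k + 1)
  rw [ho, ho', ENat.toNat_coe, ENat.toNat_coe, Nat.cast_inj, Nat.cast_inj]
  omega

/-- **K2(5) ⟺ no power-cone trap returning infinitely often to a satellite step at orders `(6, 6)` ∧ no binary-cone
trap** (idea-4's A∞/C∞ regime as the located residue of K2(5)), modulo the light-satellite recurrence K12c at `p = 5`
(hypothesis `hK12c`). [OURS · conditional on K12c] [cite: CossartJannsenSaito2020, Thm. 3.14] -/
theorem noAboveFloorTrap_five_iff_lightSlices_of
    (hK12c : ∀ (K : Type) [Field K] [CharP K 5] [DecidableEq K] (c : ℕ → State K) (d : ℕ) (j : ℕ → Fin 4)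
      (b : ℕ → Fin 4 → K), 2 ≤ d → d < 5 → (∀ e' ∈ (c 0).F.support, (c 0).r ≤ e') →
      FreeTail.IsWitnessedChain 5 c j b →
      (∀ k, IsIsolated 5 (c k).F ∧ Step0 5 (c k) (c (k + 1)) ∧ ordZero (c k).F ≠ (5 : ℕ) ∧
        (c k).shade = (d : ℕ∞) ∧ Module.finrank K (resVertex (c k)) = 3) →
      ∀ N, ∃ k, N ≤ k ∧ FreeTail.IsSatellite j b k ∧
        (ordZero (c k).F).toNat + (ordZero (c (k + 1)).F).toNat + 3 ≤ 3 * 5) :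
    NoAboveFloorTrap 5 5 ↔ ∀ (K : Type) [Field K] [CharP K 5] [DecidableEq K],
      (¬ ∃ (c : ℕ → State K) (d : ℕ) (j : ℕ → Fin 4) (b : ℕ → Fin 4 → K), 2 ≤ d ∧ d ≤ 4 ∧
          (∀ e' ∈ (c 0).F.support, (c 0).r ≤ e') ∧ FreeTail.IsWitnessedChain 5 c j b ∧
          (∀ k, IsIsolated 5 (c k).F ∧ Step0 5 (c k) (c (k + 1)) ∧ ordZero (c k).F ≠ (5 : ℕ) ∧
            (c k).shade = (d : ℕ∞) ∧ Module.finrank K (resVertex (c k)) = 3) ∧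
          ∀ N, ∃ k, N ≤ k ∧ FreeTail.IsSatellite j b k ∧
            ordZero (c k).F = (6 : ℕ) ∧ ordZero (c (k + 1)).F = (6 : ℕ)) ∧
      (¬ ∃ (c : ℕ → State K) (d : ℕ), 2 ≤ d ∧ d ≤ 4 ∧
          (∀ e' ∈ (c 0).F.support, (c 0).r ≤ e') ∧
          ∀ k, IsIsolated 5 (c k).F ∧ Step0 5 (c k) (c (k + 1)) ∧ ordZero (c k).F ≠ (5 : ℕ) ∧
            (c k).shade = (d : ℕ∞) ∧ Module.finrank K (resVertex (c k)) = 2) := by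
  haveI : Fact (Nat.Prime 5) := ⟨by norm_num⟩
  rw [noAboveFloorTrap_iff_lightSlices_of 5 hK12c]
  refine forall_congr' fun K => forall_congr' fun _ => forall_congr' fun _ => forall_congr' fun _ => ?_
  refine and_congr (not_congr ⟨?_, ?_⟩) (not_congr ⟨?_, ?_⟩)
  · rintro ⟨c, d, j, b, hd2, hdp, hr0, hw, hc, hN⟩
    refine ⟨c, d, j, b, hd2, by omega, hr0, hw, hc, fun N => ?_⟩
    obtain ⟨k, hk, hsat, hlight⟩ := hN N
    exact ⟨k, hk, hsat, (light_iff_six_six (fun k => ⟨(hc k).1, (hc k).2.1⟩) (fun k => (hc k).2.2.1) k).mp hlight⟩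
  · rintro ⟨c, d, j, b, hd2, hd4, hr0, hw, hc, hN⟩
    refine ⟨c, d, j, b, hd2, by omega, hr0, hw, hc, fun N => ?_⟩
    obtain ⟨k, hk, hsat, h66⟩ := hN N
    exact ⟨k, hk, hsat, (light_iff_six_six (fun k => ⟨(hc k).1, (hc k).2.1⟩) (fun k => (hc k).2.2.1) k).mpr h66⟩
  · rintro ⟨c, d, hd2, hdp, hr0, hc⟩
    exact ⟨c, d, hd2, by omega, hr0, hc⟩
  · rintro ⟨c, d, hd2, hd4, hr0, hc⟩
    exact ⟨c, d, hd2, by omega, hr0, hc⟩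

/-! ## APPEND — the unconditional packaging (K12c = `ResCone.lightSatellite_recurrence`, res-dim4-p-1 g3)

With res-dim4-p-1 g3's `…ResConeSatelliteResidual.lightSatellite_recurrence` (the hypothesis `hK12c` above, proved) the
packaging is UNCONDITIONAL in the kernel: «K2(p) ⟺ no LIGHT power-cone trap ∧ no binary-cone trap» and «K2(5) ⟺ no
(6,6)-satellite-recurrent power-cone trap ∧ no binary-cone trap».  Both regimes remain OPEN; nothing here proves K2(p),
K2(5) or resolution of singularities in dimension ≥ 4 / characteristic `p`. [OURS · counted 0] -/

/-- **THE LOCATED RESIDUE after the (DL) kernel: K2(p) ⟺ no LIGHT power-cone trap ∧ no binary-cone trap**, for every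
prime `p`, unconditionally in the kernel (K12c = res-dim4-p-1 g3's `lightSatellite_recurrence`). [OURS]
[cite: CossartJannsenSaito2020, Thm. 3.14] -/
theorem noAboveFloorTrap_iff_lightSlices (p : ℕ) [Fact p.Prime] :
    NoAboveFloorTrap p p ↔ ∀ (K : Type) [Field K] [CharP K p] [DecidableEq K],
      (¬ ∃ (c : ℕ → State K) (d : ℕ) (j : ℕ → Fin 4) (b : ℕ → Fin 4 → K), 2 ≤ d ∧ d < p ∧
          (∀ e' ∈ (c 0).F.support, (c 0).r ≤ e') ∧ FreeTail.IsWitnessedChain p c j b ∧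
          (∀ k, IsIsolated p (c k).F ∧ Step0 p (c k) (c (k + 1)) ∧ ordZero (c k).F ≠ p ∧
            (c k).shade = (d : ℕ∞) ∧ Module.finrank K (resVertex (c k)) = 3) ∧
          ∀ N, ∃ k, N ≤ k ∧ FreeTail.IsSatellite j b k ∧
            (ordZero (c k).F).toNat + (ordZero (c (k + 1)).F).toNat + 3 ≤ 3 * p) ∧
      (¬ ∃ (c : ℕ → State K) (d : ℕ), 2 ≤ d ∧ d < p ∧
          (∀ e' ∈ (c 0).F.support, (c 0).r ≤ e') ∧
          ∀ k, IsIsolated p (c k).F ∧ Step0 p (c k) (c (k + 1)) ∧ ordZero (c k).F ≠ p ∧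
            (c k).shade = (d : ℕ∞) ∧ Module.finrank K (resVertex (c k)) = 2) :=
  noAboveFloorTrap_iff_lightSlices_of p (lightSatellite_recurrence p)

/-- **K2(5) ⟺ no power-cone trap returning infinitely often to a satellite step at orders `(6, 6)` ∧ no binary-cone
trap**, unconditionally in the kernel. [OURS] [cite: CossartJannsenSaito2020, Thm. 3.14] -/
theorem noAboveFloorTrap_five_iff_lightSlices :
    NoAboveFloorTrap 5 5 ↔ ∀ (K : Type) [Field K] [CharP K 5] [DecidableEq K],
      (¬ ∃ (c : ℕ → State K) (d : ℕ) (j : ℕ → Fin 4) (b : ℕ → Fin 4 → K), 2 ≤ d ∧ d ≤ 4 ∧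
          (∀ e' ∈ (c 0).F.support, (c 0).r ≤ e') ∧ FreeTail.IsWitnessedChain 5 c j b ∧
          (∀ k, IsIsolated 5 (c k).F ∧ Step0 5 (c k) (c (k + 1)) ∧ ordZero (c k).F ≠ (5 : ℕ) ∧
            (c k).shade = (d : ℕ∞) ∧ Module.finrank K (resVertex (c k)) = 3) ∧
          ∀ N, ∃ k, N ≤ k ∧ FreeTail.IsSatellite j b k ∧
            ordZero (c k).F = (6 : ℕ) ∧ ordZero (c (k + 1)).F = (6 : ℕ)) ∧
      (¬ ∃ (c : ℕ → State K) (d : ℕ), 2 ≤ d ∧ d ≤ 4 ∧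
          (∀ e' ∈ (c 0).F.support, (c 0).r ≤ e') ∧
          ∀ k, IsIsolated 5 (c k).F ∧ Step0 5 (c k) (c (k + 1)) ∧ ordZero (c k).F ≠ (5 : ℕ) ∧
            (c k).shade = (d : ℕ∞) ∧ Module.finrank K (resVertex (c k)) = 2) := by
  haveI : Fact (Nat.Prime 5) := ⟨by norm_num⟩
  exact noAboveFloorTrap_five_iff_lightSlices_of (lightSatellite_recurrence 5)

end ResCone

end Summit.ResolutionOfSingularities.ResolutionOfSingularities.Theorems.PIDim4

end
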